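import Mathlib
import HarnessLib
import Summits.HubbardSuperconductivity.HubbardSuperconductivity.Theorems.KLProgrammeKLRegimeEnginePairTransferPPRateSupport
import Summits.HubbardSuperconductivity.HubbardSuperconductivity.Theorems.KLProgrammeKLRegimeSplitPhRotationRow

/-!
# Route `KLProgramme` — ENGINE (stmt-HubbardSuperconductivity-20437 `KLRegimeEngineV17F2`), row (c) binder #8 (★ v19 `hexLadMV`), value row `RP` at the diagonal:
# THE KERNELS' MODULI PART — `V(p)V(p) − V₀` enters ONLY through its sup `δ` on the hard shell, against the SIGN-BLIND born mass `2¹⁰·15367`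
# (cell gate-hubbard-kl, seat hubbard-kl-k3c2-p2 g32, technique «thermal-bar induction n ≤ nScales β + 1 with EngineBoundsAtV4S sums»; brick O6e, sequel of O6c `klph_phValue_row_le`)

WHY.  E1-LEDGER rev 13/14 line #8: the zero-transfer p-h VALUE row `RP` of binder #8 at the diagonal `k′ = k` is
`Σ_p Σ_σ (Ẇ_t(p)·βL²ĝ_p)(Φ_j(t)(p)·βL²ĝ_p)·W(p,σ)` with `W(p,σ)` the product of the two 4-point kernels INSIDE the loop sum.  Writing `W = V₀ + (W − V₀)` with a
`p`-INDEPENDENT `V₀`, the first piece is the object of the rotation lemma (O6a/O6b/O6c: thermal + DOS-slope + lattice sizes × `‖Σ_σ V₀ σ‖`), and the second is bounded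
SIGN-BLIND: `|Ẇ_t|·‖ĝ‖ ≤ (128/3)/Λ(t)²` (hard line, `abs_derivWeight_mul_norm_propCT_le`) and `Σ_k |Φ_j(t)(k)|·‖ĝ_K(k)‖ ≤ 15367·Λₙ·βL²` (soft line on an admissible
frame, `sum_softSymbol_mul_norm_propCT_le_of_frameOK`), so that in the born normalisation `(Λₙ−Λₙ₊₁)((βL²)³)⁻¹` the mass is `≤ 2⁹·15367` (the arithmetic of
`klpr_sum_norm_rate_le`, …PPRateWindow) and the moduli part costs `2¹⁰·15367·δ` with `δ := sup_{p : Ẇ_t(p) ≠ 0, σ} ‖W(p,σ) − V₀ σ‖` — the shell variation of the kernel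
product, i.e. EXACTLY the E1 datum of E1-LEDGER rev 14 §17 ((F1) corner counting × (F2) crossed-ladder regularity × (E.5d-∂)).

* `klph_sum_bornLines_norm_le` — the sign-blind born mass at the diagonal: `(Λₙ−Λₙ₊₁)((βL²)³)⁻¹·Σ_p ‖Ẇ_t(p)·βL²ĝ_p‖·‖Φ_j(t)(p)·βL²ĝ_p‖ ≤ 2⁹·15367`
  (`FrameOK` frame, `klBetaMin ≤ β ≤ L`, member `j ≥ n+1`, `t ∈ [0,1]`).
* **`klph_phValue_row_moduli_le`** — the split: for any `W : FreqMomentum → Fin 2 → ℂ`, `V₀ : Fin 2 → ℂ`, `δ ≥ 0` with `‖W p σ − V₀ σ‖ ≤ δ` wherever `Ẇ_t(p) ≠ 0`: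
  `(Λₙ−Λₙ₊₁)((βL²)³)⁻¹‖Σ_pΣ_σ(Ẇ_tβL²ĝ)(Φ_jβL²ĝ)·W p σ‖ ≤ (Λₙ−Λₙ₊₁)((βL²)³)⁻¹‖Σ_pΣ_σ(Ẇ_tβL²ĝ)(Φ_jβL²ĝ)·V₀ σ‖ + 2¹⁰·15367·δ`.
* **`klph_phValue_row_le_of_moduli`** — composed with O6c: `≤ (Λₙ−Λₙ₊₁)·‖Σ_σ V₀ σ‖·𝔅₆_b(Λ(t)) + 2¹⁰·15367·δ` (C4a chart hypotheses for the rotation part,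
  `FrameOK` for the mass).
By value (E1-LEDGER rev 14 §17, the two hands' digits): `δ ≲ 2c₄U·(U²N0Λₙ(2 + n ln4) + K³U³2^{−n})` ⇒ `2¹⁰·15367·δ` sits in `(KlamU)²·phGain` with ≥ 100 bits of room;
this file supplies no such number — it only isolates WHERE the E1 datum enters.  Pure composition over landed rows; no definitions; nothing asserts (c), K3 or
superconductivity.  [cite: BenfattoGiulianiMastropietro2006, §2.4–§2.5]
-/

noncomputable section

namespace Summit.HubbardSuperconductivity.HubbardSuperconductivity.Theorems.KLRegimeSplit

set_option linter.dupNamespace false -- summit = problem name (single-conjunct summit), D-0017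

open Real Set Finset Literature.MathematicalPhysics.QuantumLattice
open Literature.Probability.LatticeModels hiding torusSupNorm
open Literature.MathematicalPhysics.QuantumLattice.BandSectorCounting
open Summit.HubbardSuperconductivity.HubbardSuperconductivity.Theorems.TwoPointAssembly
open Summit.HubbardSuperconductivity.HubbardSuperconductivity.Theorems.KLProgrammeLegKernels
open Summit.HubbardSuperconductivity.HubbardSuperconductivity.Theorems.KLRegimeWick
open Summit.HubbardSuperconductivity.HubbardSuperconductivity.Theorems.EngineV8
open Summit.HubbardSuperconductivity.HubbardSuperconductivity.Theorems.DispersionFlow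
open Summit.HubbardSuperconductivity.HubbardSuperconductivity.Theorems.PerturbedFermiCurve

variable {L M : ℕ} [NeZero L] [NeZero M]

/-! ## §1 The sign-blind born mass at the diagonal -/

section Mass

variable {R : RenConsts} {U : ℝ} {N : ℕ}

omit [NeZero L] [NeZero M] in
/-- Slice arithmetic: `(Λₙ − Λₙ₊₁)·Λₙ/Λ(t)² ≤ 12` for `Λ(t) ∈ [Λₙ₊₁, Λₙ]`, `Λₙ₊₁ = Λₙ/4`. -/
private theorem klph_slice_ratio_le (n : ℕ) {t : ℝ} (ht : t ∈ Icc (0 : ℝ) 1) :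
    (klScale klE0 n - klScale klE0 (n + 1)) * klScale klE0 n / (klScale klE0 n + t * (klScale klE0 (n + 1) - klScale klE0 n)) ^ 2 ≤ 12 := by
  have h10 := (klmf_klScale_succ_pos_le n).2
  have h1 := (klmf_klScale_succ_pos_le n).1
  have hΛn : 0 < klScale klE0 n := klth_klScale_pos n
  have hsucc : klScale klE0 (n + 1) = klScale klE0 n / 4 := klth_klScale_succ n
  have hmem := klws_affine_mem_Icc h10 ht
  calc (klScale klE0 n - klScale klE0 (n + 1)) * klScale klE0 n / (klScale klE0 n + t * (klScale klE0 (n + 1) - klScale klE0 n)) ^ 2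
      ≤ (klScale klE0 n - klScale klE0 (n + 1)) * klScale klE0 n / (klScale klE0 (n + 1)) ^ 2 :=
        div_le_div_of_nonneg_left (by nlinarith) (by positivity) (pow_le_pow_left₀ h1.le hmem.1 2)
    _ = 12 := by rw [hsucc]; field_simp; ring

omit [NeZero L] [NeZero M] in
/-- The norm of the born line pair at one label: `‖Ẇ·(βL²ĝ)‖·‖Φ·(βL²ĝ)‖ = (βL²)²·(|Ẇ|‖ĝ‖)·(|Φ|‖ĝ‖)` (`0 < βL²`). -/
theorem klph_norm_bornLines_eq {β : ℝ} (hβL : 0 < β * (L : ℝ) ^ 2) (μ : ℝ) (K : TrigPolyC4v) (w φ : ℝ) (p : FreqMomentum L M) :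
    ‖(((w : ℝ) : ℂ) * (((β * (L : ℝ) ^ 2 : ℝ) : ℂ) * propCT L M β μ K p))‖ * ‖(((φ : ℝ) : ℂ) * (((β * (L : ℝ) ^ 2 : ℝ) : ℂ) * propCT L M β μ K p))‖ =
      (β * (L : ℝ) ^ 2) ^ 2 * ((|w| * ‖propCT L M β μ K p‖) * (|φ| * ‖propCT L M β μ K p‖)) := by
  have h1 : ‖(((β * (L : ℝ) ^ 2 : ℝ) : ℂ))‖ = β * (L : ℝ) ^ 2 := by
    rw [Complex.norm_real, Real.norm_of_nonneg hβL.le]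
  rw [norm_mul, norm_mul, norm_mul, norm_mul, h1, Complex.norm_real, Complex.norm_real, Real.norm_eq_abs, Real.norm_eq_abs]
  ring

omit [NeZero M] in
/-- **The sign-blind born mass at the diagonal**: on an admissible frame (`FrameOK`), `klBetaMin ≤ β ≤ L`, member `j ≥ n+1`, `t ∈ [0,1]`:
`(Λₙ−Λₙ₊₁)((βL²)³)⁻¹·Σ_p ‖Ẇ_t(p)·βL²ĝ_p‖·‖Φ_j(t)(p)·βL²ĝ_p‖ ≤ 2⁹·15367` — hard line `(128/3)/Λ(t)²`, soft sum `15367·Λₙ·βL²`, slice ratio `≤ 12`. -/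
theorem klph_sum_bornLines_norm_le {β μ : ℝ} {K : TrigPolyC4v} (hK : FrameOK R U N μ K) (hβ : klBetaMin ≤ β) (hβL : β ≤ L) (n : ℕ) {t : ℝ}
    (ht : t ∈ Icc (0 : ℝ) 1)
    (Φ : ℕ → ℝ → FreqMomentum L M → ℝ)
    (hΦ : Φ = fun j t k => (softSymbolCompl L M β μ K (n + 1) j) k + (hubbardCutoffWeightCT L M β μ K (klScale klE0 (n + 1)) k -
        hubbardCutoffWeightCT L M β μ K (klScale klE0 n + t * (klScale klE0 (n + 1) - klScale klE0 n)) k))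
    (Wd : ℝ → FreqMomentum L M → ℝ)
    (hWd : Wd = fun t k => deriv (fun Λ' : ℝ => hubbardCutoffWeightCT L M β μ K Λ' k) (klScale klE0 n + t * (klScale klE0 (n + 1) - klScale klE0 n)))
    {j : ℕ} (hj : n + 1 ≤ j) :
    (klScale klE0 n - klScale klE0 (n + 1)) * ((β * (L : ℝ) ^ 2) ^ 3)⁻¹ *
        ∑ p : FreqMomentum L M, ‖((((Wd t p) : ℝ) : ℂ) * (((β * (L : ℝ) ^ 2 : ℝ) : ℂ) * propCT L M β μ K p))‖ *
          ‖((((Φ j t p) : ℝ) : ℂ) * (((β * (L : ℝ) ^ 2 : ℝ) : ℂ) * propCT L M β μ K p))‖ ≤ (2 : ℝ) ^ 9 * 15367 := by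
  have hβ0 : 0 < β := pos_of_klBetaMin_le hβ
  have hL : (0 : ℝ) < L := hβ0.trans_le hβL
  have hβL2 : 0 < β * (L : ℝ) ^ 2 := by positivity
  have hΛn : 0 < klScale klE0 n := klth_klScale_pos n
  have h10 := (klmf_klScale_succ_pos_le n).2
  have h1 := (klmf_klScale_succ_pos_le n).1
  have hmem := klws_affine_mem_Icc h10 ht
  set Λt : ℝ := klScale klE0 n + t * (klScale klE0 (n + 1) - klScale klE0 n) with hΛt_def
  have hΛt : 0 < Λt := h1.trans_le hmem.1
  have hdiff : 0 ≤ klScale klE0 n - klScale klE0 (n + 1) := by linarith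
  -- admissibility of the running member symbol at scale `n`
  have hΦmem : ∀ k, 0 ≤ Φ j t k ∧ Φ j t k ≤ 1 - hubbardCutoffWeightCT L M β μ K (klScale klE0 n) k := by
    intro k
    have h := klmf_runningSymbol_mem L M β μ K n (isSoftSymbol_compl (L := L) (M := M) β μ K hj).1 ht k
    rw [hΦ]; exact h
  have hS : ∑ k : FreqMomentum L M, |Φ j t k| * ‖propCT L M β μ K k‖ ≤ 15367 * klScale klE0 n * β * (L : ℝ) ^ 2 :=
    sum_softSymbol_mul_norm_propCT_le_of_frameOK β μ K hK hβ hβL n hΦmem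
  -- the hard line, pointwise
  have hhard : ∀ p : FreqMomentum L M, |Wd t p| * ‖propCT L M β μ K p‖ ≤ 128 / 3 / Λt ^ 2 := by
    intro p
    rw [hWd]
    exact abs_derivWeight_mul_norm_propCT_le β μ K hΛt p
  have hpt : ∀ p : FreqMomentum L M,
      ‖((((Wd t p) : ℝ) : ℂ) * (((β * (L : ℝ) ^ 2 : ℝ) : ℂ) * propCT L M β μ K p))‖ *
          ‖((((Φ j t p) : ℝ) : ℂ) * (((β * (L : ℝ) ^ 2 : ℝ) : ℂ) * propCT L M β μ K p))‖ ≤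
        (β * (L : ℝ) ^ 2) ^ 2 * (128 / 3 / Λt ^ 2) * (|Φ j t p| * ‖propCT L M β μ K p‖) := by
    intro p
    rw [klph_norm_bornLines_eq hβL2 μ K (Wd t p) (Φ j t p) p]
    have hB : 0 ≤ |Φ j t p| * ‖propCT L M β μ K p‖ := by positivity
    have h2 : 0 ≤ (β * (L : ℝ) ^ 2) ^ 2 := by positivity
    have h3 : (|Wd t p| * ‖propCT L M β μ K p‖) * (|Φ j t p| * ‖propCT L M β μ K p‖) ≤
        (128 / 3 / Λt ^ 2) * (|Φ j t p| * ‖propCT L M β μ K p‖) := mul_le_mul_of_nonneg_right (hhard p) hB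
    calc (β * (L : ℝ) ^ 2) ^ 2 * ((|Wd t p| * ‖propCT L M β μ K p‖) * (|Φ j t p| * ‖propCT L M β μ K p‖))
        ≤ (β * (L : ℝ) ^ 2) ^ 2 * ((128 / 3 / Λt ^ 2) * (|Φ j t p| * ‖propCT L M β μ K p‖)) := mul_le_mul_of_nonneg_left h3 h2
      _ = _ := by ring
  calc (klScale klE0 n - klScale klE0 (n + 1)) * ((β * (L : ℝ) ^ 2) ^ 3)⁻¹ *
        ∑ p : FreqMomentum L M, ‖((((Wd t p) : ℝ) : ℂ) * (((β * (L : ℝ) ^ 2 : ℝ) : ℂ) * propCT L M β μ K p))‖ *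
          ‖((((Φ j t p) : ℝ) : ℂ) * (((β * (L : ℝ) ^ 2 : ℝ) : ℂ) * propCT L M β μ K p))‖
      ≤ (klScale klE0 n - klScale klE0 (n + 1)) * ((β * (L : ℝ) ^ 2) ^ 3)⁻¹ *
          ∑ p : FreqMomentum L M, (β * (L : ℝ) ^ 2) ^ 2 * (128 / 3 / Λt ^ 2) * (|Φ j t p| * ‖propCT L M β μ K p‖) :=
        mul_le_mul_of_nonneg_left (sum_le_sum fun p _ => hpt p) (by positivity)
    _ = (klScale klE0 n - klScale klE0 (n + 1)) * ((β * (L : ℝ) ^ 2) ^ 3)⁻¹ * ((β * (L : ℝ) ^ 2) ^ 2 * (128 / 3 / Λt ^ 2)) *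
          ∑ k : FreqMomentum L M, |Φ j t k| * ‖propCT L M β μ K k‖ := by
        rw [← Finset.mul_sum]; ring
    _ ≤ (klScale klE0 n - klScale klE0 (n + 1)) * ((β * (L : ℝ) ^ 2) ^ 3)⁻¹ * ((β * (L : ℝ) ^ 2) ^ 2 * (128 / 3 / Λt ^ 2)) *
          (15367 * klScale klE0 n * β * (L : ℝ) ^ 2) := mul_le_mul_of_nonneg_left hS (by positivity)
    _ = 128 / 3 * 15367 * ((klScale klE0 n - klScale klE0 (n + 1)) * klScale klE0 n / Λt ^ 2) := by
        field_simp
    _ ≤ 128 / 3 * 15367 * 12 := mul_le_mul_of_nonneg_left (klph_slice_ratio_le n ht) (by norm_num)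
    _ = (2 : ℝ) ^ 9 * 15367 := by norm_num

end Mass

/-! ## §2 The moduli split of the value row -/

section Moduli

variable {R : RenConsts} {U : ℝ} {N : ℕ}

omit [NeZero M] in
/-- **THE MODULI SPLIT OF THE p-h VALUE ROW AT THE DIAGONAL.**  For any kernel product `W : FreqMomentum → Fin 2 → ℂ` inside the loop sum, any `p`-independent
`V₀ : Fin 2 → ℂ` and `δ ≥ 0` with `‖W p σ − V₀ σ‖ ≤ δ` wherever the hard line lives (`Ẇ_t(p) ≠ 0`, i.e. `Λ(t)²/4 ≤ ω_p² + e_p² ≤ Λ(t)²`):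
`(Λₙ−Λₙ₊₁)((βL²)³)⁻¹‖Σ_pΣ_σ(Ẇ_tβL²ĝ)(Φ_jβL²ĝ)·W p σ‖ ≤ (Λₙ−Λₙ₊₁)((βL²)³)⁻¹‖Σ_pΣ_σ(Ẇ_tβL²ĝ)(Φ_jβL²ĝ)·V₀ σ‖ + 2¹⁰·15367·δ`
(`FrameOK` frame, `klBetaMin ≤ β ≤ L`, `j ≥ n+1`, `t ∈ [0,1]`).  The first term is O6c's object (`klph_phValue_row_le`); `δ` is the E1 datum.
[cite: BenfattoGiulianiMastropietro2006, §2.4–§2.5] -/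
theorem klph_phValue_row_moduli_le {β μ : ℝ} {K : TrigPolyC4v} (hK : FrameOK R U N μ K) (hβ : klBetaMin ≤ β) (hβL : β ≤ L) (n : ℕ) {t : ℝ}
    (ht : t ∈ Icc (0 : ℝ) 1)
    (Φ : ℕ → ℝ → FreqMomentum L M → ℝ)
    (hΦ : Φ = fun j t k => (softSymbolCompl L M β μ K (n + 1) j) k + (hubbardCutoffWeightCT L M β μ K (klScale klE0 (n + 1)) k -
        hubbardCutoffWeightCT L M β μ K (klScale klE0 n + t * (klScale klE0 (n + 1) - klScale klE0 n)) k))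
    (Wd : ℝ → FreqMomentum L M → ℝ)
    (hWd : Wd = fun t k => deriv (fun Λ' : ℝ => hubbardCutoffWeightCT L M β μ K Λ' k) (klScale klE0 n + t * (klScale klE0 (n + 1) - klScale klE0 n)))
    {j : ℕ} (hj : n + 1 ≤ j) (W : FreqMomentum L M → Fin 2 → ℂ) (V₀ : Fin 2 → ℂ) {δ : ℝ} (hδ0 : 0 ≤ δ)
    (hδ : ∀ p : FreqMomentum L M, ∀ σ : Fin 2, Wd t p ≠ 0 → ‖W p σ - V₀ σ‖ ≤ δ) :
    (klScale klE0 n - klScale klE0 (n + 1)) * ((β * (L : ℝ) ^ 2) ^ 3)⁻¹ *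
        ‖∑ p : FreqMomentum L M, ∑ σ : Fin 2,
          (((((Wd t p) : ℝ) : ℂ) * (((β * (L : ℝ) ^ 2 : ℝ) : ℂ) * propCT L M β μ K p)) * ((((Φ j t p) : ℝ) : ℂ) * (((β * (L : ℝ) ^ 2 : ℝ) : ℂ) * propCT L M β μ K p))) *
            W p σ‖ ≤
      (klScale klE0 n - klScale klE0 (n + 1)) * ((β * (L : ℝ) ^ 2) ^ 3)⁻¹ *
          ‖∑ p : FreqMomentum L M, ∑ σ : Fin 2,
            (((((Wd t p) : ℝ) : ℂ) * (((β * (L : ℝ) ^ 2 : ℝ) : ℂ) * propCT L M β μ K p)) * ((((Φ j t p) : ℝ) : ℂ) * (((β * (L : ℝ) ^ 2 : ℝ) : ℂ) * propCT L M β μ K p))) *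
              V₀ σ‖ +
        (2 : ℝ) ^ 10 * 15367 * δ := by
  have hβ0 : 0 < β := pos_of_klBetaMin_le hβ
  have hL : (0 : ℝ) < L := hβ0.trans_le hβL
  have hβL2 : 0 < β * (L : ℝ) ^ 2 := by positivity
  have h10 := (klmf_klScale_succ_pos_le n).2
  have hdiff : 0 ≤ klScale klE0 n - klScale klE0 (n + 1) := by linarith
  have hC : 0 ≤ (klScale klE0 n - klScale klE0 (n + 1)) * ((β * (L : ℝ) ^ 2) ^ 3)⁻¹ := by positivity
  -- abbreviations
  set line : FreqMomentum L M → ℂ := fun p =>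
    ((((Wd t p) : ℝ) : ℂ) * (((β * (L : ℝ) ^ 2 : ℝ) : ℂ) * propCT L M β μ K p)) * ((((Φ j t p) : ℝ) : ℂ) * (((β * (L : ℝ) ^ 2 : ℝ) : ℂ) * propCT L M β μ K p))
    with hline_def
  -- split `W = V₀ + (W − V₀)`
  have hsplit : ∑ p : FreqMomentum L M, ∑ σ : Fin 2, line p * W p σ =
      (∑ p : FreqMomentum L M, ∑ σ : Fin 2, line p * V₀ σ) + ∑ p : FreqMomentum L M, ∑ σ : Fin 2, line p * (W p σ - V₀ σ) := by
    rw [← sum_add_distrib]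
    refine sum_congr rfl fun p _ => ?_
    rw [← sum_add_distrib]
    refine sum_congr rfl fun σ _ => ?_
    ring
  -- the moduli piece, termwise
  have hterm : ∀ p : FreqMomentum L M, ∀ σ : Fin 2, ‖line p * (W p σ - V₀ σ)‖ ≤ ‖line p‖ * δ := by
    intro p σ
    rw [norm_mul]
    by_cases hp : Wd t p = 0
    · have : line p = 0 := by simp only [hline_def, hp, Complex.ofReal_zero, zero_mul]
      rw [this, norm_zero, zero_mul, zero_mul]
    · exact mul_le_mul_of_nonneg_left (hδ p σ hp) (norm_nonneg _)
  have hmod : ‖∑ p : FreqMomentum L M, ∑ σ : Fin 2, line p * (W p σ - V₀ σ)‖ ≤ 2 * δ * ∑ p : FreqMomentum L M, ‖line p‖ := by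
    calc ‖∑ p : FreqMomentum L M, ∑ σ : Fin 2, line p * (W p σ - V₀ σ)‖
        ≤ ∑ p : FreqMomentum L M, ‖∑ σ : Fin 2, line p * (W p σ - V₀ σ)‖ := norm_sum_le _ _
      _ ≤ ∑ p : FreqMomentum L M, ∑ σ : Fin 2, ‖line p * (W p σ - V₀ σ)‖ := sum_le_sum fun p _ => norm_sum_le _ _
      _ ≤ ∑ p : FreqMomentum L M, ∑ σ : Fin 2, ‖line p‖ * δ := sum_le_sum fun p _ => sum_le_sum fun σ _ => hterm p σ
      _ = 2 * δ * ∑ p : FreqMomentum L M, ‖line p‖ := by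
          simp only [Fin.sum_univ_two, Finset.mul_sum]
          refine sum_congr rfl fun p _ => ?_
          ring
  -- the sign-blind mass
  have hmass := klph_sum_bornLines_norm_le (L := L) (M := M) hK hβ hβL n ht Φ hΦ Wd hWd hj
  have hnl : ∀ p : FreqMomentum L M, ‖line p‖ =
      ‖((((Wd t p) : ℝ) : ℂ) * (((β * (L : ℝ) ^ 2 : ℝ) : ℂ) * propCT L M β μ K p))‖ *
        ‖((((Φ j t p) : ℝ) : ℂ) * (((β * (L : ℝ) ^ 2 : ℝ) : ℂ) * propCT L M β μ K p))‖ := fun p => norm_mul _ _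
  have hmass' : (klScale klE0 n - klScale klE0 (n + 1)) * ((β * (L : ℝ) ^ 2) ^ 3)⁻¹ * ∑ p : FreqMomentum L M, ‖line p‖ ≤ (2 : ℝ) ^ 9 * 15367 := by
    simp only [hnl]; exact hmass
  -- assemble
  calc (klScale klE0 n - klScale klE0 (n + 1)) * ((β * (L : ℝ) ^ 2) ^ 3)⁻¹ * ‖∑ p : FreqMomentum L M, ∑ σ : Fin 2, line p * W p σ‖
      = (klScale klE0 n - klScale klE0 (n + 1)) * ((β * (L : ℝ) ^ 2) ^ 3)⁻¹ *
          ‖(∑ p : FreqMomentum L M, ∑ σ : Fin 2, line p * V₀ σ) + ∑ p : FreqMomentum L M, ∑ σ : Fin 2, line p * (W p σ - V₀ σ)‖ := by rw [hsplit]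
    _ ≤ (klScale klE0 n - klScale klE0 (n + 1)) * ((β * (L : ℝ) ^ 2) ^ 3)⁻¹ *
          (‖∑ p : FreqMomentum L M, ∑ σ : Fin 2, line p * V₀ σ‖ + 2 * δ * ∑ p : FreqMomentum L M, ‖line p‖) :=
        mul_le_mul_of_nonneg_left ((norm_add_le _ _).trans (by linarith [hmod])) hC
    _ = (klScale klE0 n - klScale klE0 (n + 1)) * ((β * (L : ℝ) ^ 2) ^ 3)⁻¹ * ‖∑ p : FreqMomentum L M, ∑ σ : Fin 2, line p * V₀ σ‖ +
          2 * δ * ((klScale klE0 n - klScale klE0 (n + 1)) * ((β * (L : ℝ) ^ 2) ^ 3)⁻¹ * ∑ p : FreqMomentum L M, ‖line p‖) := by ring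
    _ ≤ (klScale klE0 n - klScale klE0 (n + 1)) * ((β * (L : ℝ) ^ 2) ^ 3)⁻¹ * ‖∑ p : FreqMomentum L M, ∑ σ : Fin 2, line p * V₀ σ‖ +
          2 * δ * ((2 : ℝ) ^ 9 * 15367) := by
        have : 2 * δ * ((klScale klE0 n - klScale klE0 (n + 1)) * ((β * (L : ℝ) ^ 2) ^ 3)⁻¹ * ∑ p : FreqMomentum L M, ‖line p‖) ≤
            2 * δ * ((2 : ℝ) ^ 9 * 15367) := mul_le_mul_of_nonneg_left hmass' (by positivity)
        linarith
    _ = (klScale klE0 n - klScale klE0 (n + 1)) * ((β * (L : ℝ) ^ 2) ^ 3)⁻¹ * ‖∑ p : FreqMomentum L M, ∑ σ : Fin 2, line p * V₀ σ‖ +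
          (2 : ℝ) ^ 10 * 15367 * δ := by ring

end Moduli

/-! ## §3 Composition with the rotation lemma (O6c) -/

section Composed

variable {R : RenConsts} {U : ℝ} {N : ℕ}

/-- **THE p-h VALUE ROW AT THE DIAGONAL, ROTATION + MODULI.**  Under the C4a chart hypotheses of `klph_phValue_row_le` (for the frequency-pinned part `V₀`) and an
admissible frame `FrameOK R U N μ K`, `klBetaMin ≤ β ≤ L`, `j ≥ n+1` (for the sign-blind mass): for every kernel product `W` with `‖W p σ − V₀ σ‖ ≤ δ` on the hard shell,
`(Λₙ−Λₙ₊₁)((βL²)³)⁻¹‖Σ_pΣ_σ(Ẇ_tβL²ĝ)(Φ_jβL²ĝ)·W p σ‖ ≤ (Λₙ−Λₙ₊₁)·‖Σ_σ V₀ σ‖·𝔅₆_b(Λ(t)) + 2¹⁰·15367·δ`.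
[cite: BenfattoGiulianiMastropietro2006, §2.4–§2.5] -/
theorem klph_phValue_row_le_of_moduli {β μ : ℝ} {K : TrigPolyC4v} (hK : FrameOK R U N μ K) (hβ : klBetaMin ≤ β) (hβL : β ≤ L)
    {a b : ℝ} (B : BandBounds a b) {A : ℝ} (hA : ∀ p : Momentum, ∀ j ≤ 2, ‖iteratedFDeriv ℝ j (frameShift K) p‖ ≤ A) (hADt : 2 * A < B.Dtmin)
    {r : ℝ} (hlo : a < μ - r - A) (hhi : μ + r + A < b) (n : ℕ) {t : ℝ} (ht : t ∈ Icc (0 : ℝ) 1)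
    (Φ : ℕ → ℝ → FreqMomentum L M → ℝ) (hΦ : Φ = fun j t k => (softSymbolCompl L M β μ K (n + 1) j) k + (hubbardCutoffWeightCT L M β μ K (klScale klE0 (n + 1)) k -
            hubbardCutoffWeightCT L M β μ K (klScale klE0 n + t * (klScale klE0 (n + 1) - klScale klE0 n)) k))
    (Wd : ℝ → FreqMomentum L M → ℝ) (hWd : Wd = fun t k => deriv (fun Λ' : ℝ => hubbardCutoffWeightCT L M β μ K Λ' k) (klScale klE0 n + t * (klScale klE0 (n + 1) - klScale klE0 n)))
    {j : ℕ} (hj : n + 1 ≤ j) (hΛr : klScale klE0 n + t * (klScale klE0 (n + 1) - klScale klE0 n) < r)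
    (hM : β * (klScale klE0 n + t * (klScale klE0 (n + 1) - klScale klE0 n)) / (2 * Real.pi) + 1 ≤ M)
    {Mg ℓ r₁ : ℝ} (hr₁ : 0 < r₁)
    (hbd : ∀ s, |klWd (klScale klE0 n + t * (klScale klE0 (n + 1) - klScale klE0 n)) s *
      klPhi (klScale klE0 j) (klScale klE0 n + t * (klScale klE0 (n + 1) - klScale klE0 n)) s| ≤ Mg)
    (hlip : ∀ s s', |klWd (klScale klE0 n + t * (klScale klE0 (n + 1) - klScale klE0 n)) s *
        klPhi (klScale klE0 j) (klScale klE0 n + t * (klScale klE0 (n + 1) - klScale klE0 n)) s -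
      klWd (klScale klE0 n + t * (klScale klE0 (n + 1) - klScale klE0 n)) s' *
        klPhi (klScale klE0 j) (klScale klE0 n + t * (klScale klE0 (n + 1) - klScale klE0 n)) s'| ≤ ℓ * |s - s'|)
    (hin : ∀ s, s ≤ r₁ ^ 2 → klWd (klScale klE0 n + t * (klScale klE0 (n + 1) - klScale klE0 n)) s *
      klPhi (klScale klE0 j) (klScale klE0 n + t * (klScale klE0 (n + 1) - klScale klE0 n)) s = 0)
    (hout : ∀ s, (klScale klE0 n + t * (klScale klE0 (n + 1) - klScale klE0 n)) ^ 2 ≤ s →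
      klWd (klScale klE0 n + t * (klScale klE0 (n + 1) - klScale klE0 n)) s *
        klPhi (klScale klE0 j) (klScale klE0 n + t * (klScale klE0 (n + 1) - klScale klE0 n)) s = 0)
    (W : FreqMomentum L M → Fin 2 → ℂ) (V₀ : Fin 2 → ℂ) {δ : ℝ} (hδ0 : 0 ≤ δ)
    (hδ : ∀ p : FreqMomentum L M, ∀ σ : Fin 2, Wd t p ≠ 0 → ‖W p σ - V₀ σ‖ ≤ δ) :
    (klScale klE0 n - klScale klE0 (n + 1)) * ((β * (L : ℝ) ^ 2) ^ 3)⁻¹ *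
      ‖∑ p : FreqMomentum L M, ∑ σ : Fin 2,
        (((((Wd t p) : ℝ) : ℂ) * (((β * (L : ℝ) ^ 2 : ℝ) : ℂ) * propCT L M β μ K p)) * ((((Φ j t p) : ℝ) : ℂ) * (((β * (L : ℝ) ^ 2 : ℝ) : ℂ) * propCT L M β μ K p))) *
          W p σ‖ ≤
      (klScale klE0 n - klScale klE0 (n + 1)) * ‖∑ σ : Fin 2, V₀ σ‖ *
        (((2 * π) ^ 2)⁻¹ * (2 * π * (π * Real.sqrt 2 / (B.Dtmin - 2 * A)) *
              ((2 * (klScale klE0 n + t * (klScale klE0 (n + 1) - klScale klE0 n)) * (2 * (klScale klE0 n + t * (klScale klE0 (n + 1) - klScale klE0 n)) *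
                (2 * (klScale klE0 n + t * (klScale klE0 (n + 1) - klScale klE0 n)) ^ 2 * (ℓ / r₁ ^ 4 + 2 * Mg / r₁ ^ 6) + (ℓ / r₁ ^ 2 + Mg / r₁ ^ 4)))) *
                ((klScale klE0 n + t * (klScale klE0 (n + 1) - klScale klE0 n)) + 2 * Real.pi / β) / β) +
            β⁻¹ * (((klScale klE0 n + t * (klScale klE0 (n + 1) - klScale klE0 n)) * β / π + 1) *
              (2 * (klScale klE0 n + t * (klScale klE0 (n + 1) - klScale klE0 n)) *
                (2 * π * (1 / (B.Dtmin - 2 * A) ^ 2 + Real.pi * Real.sqrt 2 * (2 + 4 * A) / (B.Dtmin - 2 * A) ^ 3) *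
                  (klScale klE0 n + t * (klScale klE0 (n + 1) - klScale klE0 n)) * (Mg / r₁ ^ 2))))) +
          ((klScale klE0 n + t * (klScale klE0 (n + 1) - klScale klE0 n)) / π + 3 / β) *
            (2 * π * (2 * (klScale klE0 n + t * (klScale klE0 (n + 1) - klScale klE0 n)) *
              (2 * (klScale klE0 n + t * (klScale klE0 (n + 1) - klScale klE0 n)) ^ 2 * (ℓ / r₁ ^ 4 + 2 * Mg / r₁ ^ 6) + (ℓ / r₁ ^ 2 + Mg / r₁ ^ 4)) *
              (4 + 2 * A)) / L)) +
        (2 : ℝ) ^ 10 * 15367 * δ := by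
  have hβ0 : 0 < β := pos_of_klBetaMin_le hβ
  have hsplit := klph_phValue_row_moduli_le (L := L) (M := M) hK hβ hβL n ht Φ hΦ Wd hWd hj W V₀ hδ0 hδ
  have hrot := klph_phValue_row_le (L := L) (M := M) hβ0 μ B hA hADt hlo hhi n ht Φ hΦ Wd hWd j hΛr hM hr₁ hbd hlip hin hout V₀
  linarith

end Composed

end Summit.HubbardSuperconductivity.HubbardSuperconductivity.Theorems.KLRegimeSplit

end
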